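import Summits.ResolutionOfSingularities.ResolutionOfSingularities.Theorems.RadicialJungCleanModelsCcurveRegResidue
import HarnessLib

/-!
# Route `RadicialJung`, crux `CleanModels` (stmt-15917) — (C-curve) sub-line, `curveRegularize` (classical route) III: images of subrings of the local ring at the
# centre curve in its residue field

Lead `res-B-lead-1` g7 (workfile `Lines/Sketch_Ccurve_assembly.lean` v2.9, S3-core `stub_Cc_curveRegularize`; classical, F-32-free route).  OURS · counted 0.
Nothing here proves resolution in characteristic `p`; resolution in char `p` is NOT proved.

Setting of `…CcurveRegResidue`: `R₁ ⊆ O₁` local with `O₁`-units invertible, `O ≤ O₁`, `V̄ ⊆ L = κ(R₁)` the residue valuation ring of `O`.  For a subring `T ⊆ R₁`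
its IMAGE in `L` is the range of `residue ∘ inclusion` (no definition is introduced; the range term is spelled out).  This file: membership (`mem_img_iff`),
`img T ⊆ V̄` (`img_le_residueVal`), domination of the image by `V̄` when the `O`-units of `T` are invertible in `T` (`img_dominated`), the image is a local ring
and every element of `L` is a fraction of elements of the image (`isLocalRingOf_img`), the image of the maximal ideal (`map_maximalIdeal_img`), and the key
computation `img (locAtCentre C O) = locAtCentre (img C) V̄` (`img_locAtCentre`).
-/

noncomputable section

set_option linter.dupNamespace false

open IsLocalRing Literature.AlgebraicGeometry.Resolution
open Summit.ResolutionOfSingularities.ResolutionOfSingularities.Theorems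
open Summit.ResolutionOfSingularities.ResolutionOfSingularities.Theorems.SwitchingDichotomy

namespace Summit.ResolutionOfSingularities.ResolutionOfSingularities.Theorems.RadicialJung.CleanModels.Ccurve

variable {K : Type} [Field K]

section image

variable {R₁ : Subring K} [IsLocalRing ↥R₁] {O O₁ : ValuationSubring K} (hOO₁ : O ≤ O₁) (hR₁O₁ : R₁ ≤ O₁.toSubring)
  (hinv : ∀ {r : K}, r ∈ R₁ → O₁.valuation r = 1 → r⁻¹ ∈ R₁)
  (V : ValuationSubring (ResidueField ↥R₁)) (hV₁ : ∀ r : ↥R₁, (r : K) ∈ O → residue ↥R₁ r ∈ V)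
  (hV₂ : ∀ ξ : ResidueField ↥R₁, ξ ∈ V → ∃ r : ↥R₁, (r : K) ∈ O ∧ residue ↥R₁ r = ξ)

omit [IsLocalRing ↥R₁] in
/-- The composite `residue ∘ inclusion` on an element. [folklore] -/
theorem residue_comp_inclusion_apply [IsLocalRing ↥R₁] {T : Subring K} (hT : T ≤ R₁) (t : ↥T) :
    ((residue ↥R₁).comp (Subring.inclusion hT)) t = residue ↥R₁ ⟨(t : K), hT t.2⟩ := rfl

/-- Membership in the image of `T ⊆ R₁` in the residue field. [folklore] -/
theorem mem_img_iff {T : Subring K} (hT : T ≤ R₁) (ξ : ResidueField ↥R₁) :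
    ξ ∈ ((residue ↥R₁).comp (Subring.inclusion hT)).range ↔ ∃ (t : K) (ht : t ∈ T), residue ↥R₁ ⟨t, hT ht⟩ = ξ := by
  rw [RingHom.mem_range]
  constructor
  · rintro ⟨t, rfl⟩; exact ⟨t, t.2, rfl⟩
  · rintro ⟨t, ht, rfl⟩; exact ⟨⟨t, ht⟩, rfl⟩

/-- The residue of an element of `T` lies in the image of `T`. [folklore] -/
theorem residue_mem_img {T : Subring K} (hT : T ≤ R₁) {t : K} (ht : t ∈ T) :
    residue ↥R₁ ⟨t, hT ht⟩ ∈ ((residue ↥R₁).comp (Subring.inclusion hT)).range :=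
  (mem_img_iff hT _).mpr ⟨t, ht, rfl⟩

/-- Images are monotone. [folklore] -/
theorem img_mono {T T' : Subring K} (hT : T ≤ R₁) (hT' : T' ≤ R₁) (h : T ≤ T') :
    ((residue ↥R₁).comp (Subring.inclusion hT)).range ≤ ((residue ↥R₁).comp (Subring.inclusion hT')).range := by
  intro ξ hξ
  obtain ⟨t, ht, rfl⟩ := (mem_img_iff hT ξ).mp hξ
  exact residue_mem_img hT' (h ht)

include hV₁ in
/-- The image of `T ⊆ R₁ ∩ O` lies in `V̄`. [folklore] -/
theorem img_le_residueVal {T : Subring K} (hT : T ≤ R₁) (hTO : T ≤ O.toSubring) :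
    ((residue ↥R₁).comp (Subring.inclusion hT)).range ≤ V.toSubring := by
  intro ξ hξ
  obtain ⟨t, ht, rfl⟩ := (mem_img_iff hT ξ).mp hξ
  exact hV₁ _ (hTO ht)

include hOO₁ hR₁O₁ hinv hV₁ hV₂ in
/-- `V̄` dominates the image of `T` when the `O`-units of `T` are invertible in `T` (e.g. `T = locAtCentre A' O`). [folklore] -/
theorem img_dominated {T : Subring K} (hT : T ≤ R₁) (hTO : T ≤ O.toSubring) (hTinv : ∀ t ∈ T, O.valuation t = 1 → t⁻¹ ∈ T) :
    SubringDominates ((residue ↥R₁).comp (Subring.inclusion hT)).range V.toSubring := by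
  refine ⟨img_le_residueVal V hV₁ hT hTO, fun ξ hξ hξinv => ?_⟩
  obtain ⟨t, ht, rfl⟩ := (mem_img_iff hT ξ).mp hξ
  by_cases h0 : residue ↥R₁ ⟨t, hT ht⟩ = 0
  · rw [h0, inv_zero]; exact Subring.zero_mem _
  · have ht1 : O₁.valuation t = 1 := (residue_ne_zero_iff_coarse hR₁O₁ hinv ⟨t, hT ht⟩).mp h0
    have hres : residue ↥R₁ ⟨t⁻¹, hinv (hT ht) ht1⟩ = (residue ↥R₁ ⟨t, hT ht⟩)⁻¹ := residue_inv_coarse hinv ⟨t, hT ht⟩ ht1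
    rw [← hres] at hξinv ⊢
    have htinvO : t⁻¹ ∈ O := (mem_residueVal_iff hOO₁ hR₁O₁ hinv V hV₁ hV₂ ⟨t⁻¹, hinv (hT ht) ht1⟩).mp hξinv
    have hvt : O.valuation t = 1 :=
      (valuation_eq_one_iff_mem_and_inv_mem O (ne_zero_of_valuation_eq_one ht1)).mpr ⟨hTO ht, htinvO⟩
    exact residue_mem_img hT (hTinv t ht hvt)

include hR₁O₁ hinv in
/-- The image of `T` is a local ring, and every element of `L` is a fraction of elements of the image as soon as every element of `R₁` is a fraction of
elements of `T` with an `O₁`-unit denominator. [folklore] -/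
theorem isLocalRingOf_img {T : Subring K} (hT : T ≤ R₁) [IsLocalRing ↥T]
    (hfrac : ∀ r ∈ R₁, ∃ a ∈ T, ∃ b ∈ T, O₁.valuation b = 1 ∧ r = a / b) :
    IsLocalRingOf ((residue ↥R₁).comp (Subring.inclusion hT)).range := by
  refine ⟨IsLocalRing.of_surjective' _ (RingHom.rangeRestrict_surjective ((residue ↥R₁).comp (Subring.inclusion hT))), fun ξ => ?_⟩
  obtain ⟨r, rfl⟩ := residue_surjective ξ
  obtain ⟨a, ha, b, hb, hvb, hr⟩ := hfrac r r.2
  have hb0 : residue ↥R₁ ⟨b, hT hb⟩ ≠ 0 := (residue_ne_zero_iff_coarse hR₁O₁ hinv ⟨b, hT hb⟩).mpr hvb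
  refine ⟨_, residue_mem_img hT ha, _, residue_mem_img hT hb, hb0, ?_⟩
  rw [eq_div_iff hb0, ← map_mul]
  congr 1
  apply Subtype.ext
  change (r : K) * b = a
  rw [hr, div_mul_cancel₀ _ (ne_zero_of_valuation_eq_one hvb)]

/-- The maximal ideal of the image is the image of the maximal ideal (for `T` local). [folklore] -/
theorem map_maximalIdeal_img {T : Subring K} (hT : T ≤ R₁) [IsLocalRing ↥T] :
    haveI := IsLocalRing.of_surjective' _ (RingHom.rangeRestrict_surjective ((residue ↥R₁).comp (Subring.inclusion hT)))
    (maximalIdeal ↥T).map ((residue ↥R₁).comp (Subring.inclusion hT)).rangeRestrict =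
      maximalIdeal ↥((residue ↥R₁).comp (Subring.inclusion hT)).range := by
  haveI := IsLocalRing.of_surjective' _ (RingHom.rangeRestrict_surjective ((residue ↥R₁).comp (Subring.inclusion hT)))
  exact IsLocalRing.map_maximalIdeal_of_surjective _ (RingHom.rangeRestrict_surjective _)

include hOO₁ hR₁O₁ hinv hV₁ hV₂ in
/-- **Image of a localisation at the centre**: for `C ⊆ R₁ ∩ O`, the image of `locAtCentre C O` is `locAtCentre (img C) V̄`. [folklore] -/
theorem img_locAtCentre {C : Subring K} (hC : C ≤ R₁) (hC' : locAtCentre C O ≤ R₁) :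
    ((residue ↥R₁).comp (Subring.inclusion hC')).range = locAtCentre ((residue ↥R₁).comp (Subring.inclusion hC)).range V := by
  apply le_antisymm
  · intro ξ hξ
    obtain ⟨w, hw, rfl⟩ := (mem_img_iff hC' ξ).mp hξ
    obtain ⟨a, ha, b, hb, hvb, rfl⟩ := mem_locAtCentre_iff.mp hw
    have hb1 : O₁.valuation b = 1 := Shannon.valuation_eq_one_of_le hOO₁ hvb
    have hb0 : b ≠ 0 := ne_zero_of_valuation_eq_one hvb
    have hbinv : b⁻¹ ∈ R₁ := hinv (hC hb) hb1
    have hb0' : residue ↥R₁ ⟨b, hC hb⟩ ≠ 0 := (residue_ne_zero_iff_coarse hR₁O₁ hinv ⟨b, hC hb⟩).mpr hb1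
    have hres : residue ↥R₁ ⟨a / b, hC' hw⟩ = residue ↥R₁ ⟨a, hC ha⟩ / residue ↥R₁ ⟨b, hC hb⟩ := by
      rw [eq_div_iff hb0', ← map_mul]
      congr 1
      apply Subtype.ext
      change a / b * b = a
      rw [div_mul_cancel₀ _ hb0]
    rw [hres]
    refine ⟨_, residue_mem_img hC ha, _, residue_mem_img hC hb, ?_, rfl⟩
    exact (residueVal_eq_one_iff hOO₁ hR₁O₁ hinv V hV₁ hV₂ ⟨b, hC hb⟩ hb1).mpr hvb
  · rintro ξ ⟨ya, hya, zb, hzb, hvz, rfl⟩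
    obtain ⟨a, ha, rfl⟩ := (mem_img_iff hC _).mp hya
    obtain ⟨b, hb, rfl⟩ := (mem_img_iff hC _).mp hzb
    have hb0' : residue ↥R₁ ⟨b, hC hb⟩ ≠ 0 := ne_zero_of_valuation_eq_one hvz
    have hb1 : O₁.valuation b = 1 := (residue_ne_zero_iff_coarse hR₁O₁ hinv ⟨b, hC hb⟩).mp hb0'
    have hvb : O.valuation b = 1 := (residueVal_eq_one_iff hOO₁ hR₁O₁ hinv V hV₁ hV₂ ⟨b, hC hb⟩ hb1).mp hvz
    have hw : a / b ∈ locAtCentre C O := ⟨a, ha, b, hb, hvb, rfl⟩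
    refine (mem_img_iff hC' _).mpr ⟨a / b, hw, ?_⟩
    rw [eq_div_iff hb0', ← map_mul]
    congr 1
    apply Subtype.ext
    change a / b * b = a
    rw [div_mul_cancel₀ _ (ne_zero_of_valuation_eq_one hb1)]

include hR₁O₁ hinv in
open scoped Classical in
/-- **Image of a closure**: for `T ⊆ R₁` and finitely many fractions `y/u₀` (`y ∈ u ⊆ T`, `u₀` an `O₁`-unit of `T`), the image of
`closure (T ∪ {y/u₀})` is `closure (img T ∪ {res y / res u₀})`. [folklore] -/
theorem img_closure {T : Subring K} (hT : T ≤ R₁) (u : Finset ↥T) (u₀ : ↥T) (hu₀ : O₁.valuation (u₀ : K) = 1)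
    (hC : Subring.closure ((T : Set K) ∪ (fun y : ↥T => (y : K) / u₀) '' ↑u) ≤ R₁) :
    ((residue ↥R₁).comp (Subring.inclusion hC)).range =
      Subring.closure ((((residue ↥R₁).comp (Subring.inclusion hT)).range : Set (ResidueField ↥R₁)) ∪
        (fun y : ↥((residue ↥R₁).comp (Subring.inclusion hT)).range =>
          (y : ResidueField ↥R₁) / ((residue ↥R₁).comp (Subring.inclusion hT)).rangeRestrict u₀) ''
          ↑(u.image ((residue ↥R₁).comp (Subring.inclusion hT)).rangeRestrict)) := by
  have hu₀R : ((u₀ : K))⁻¹ ∈ R₁ := hinv (hT u₀.2) hu₀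
  have hTC : T ≤ Subring.closure ((T : Set K) ∪ (fun y : ↥T => (y : K) / u₀) '' ↑u) := fun t ht =>
    Subring.subset_closure (Or.inl ht)
  -- residues of the new generators
  have hgen : ∀ (y : ↥T) (hy : y ∈ u), residue ↥R₁ ⟨(y : K) / u₀, hC (Subring.subset_closure (Or.inr ⟨y, hy, rfl⟩))⟩ =
      (((residue ↥R₁).comp (Subring.inclusion hT)).rangeRestrict y : ResidueField ↥R₁) /
        ((residue ↥R₁).comp (Subring.inclusion hT)).rangeRestrict u₀ := by
    intro y hy
    change _ = residue ↥R₁ ⟨(y : K), hT y.2⟩ / residue ↥R₁ ⟨(u₀ : K), hT u₀.2⟩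
    have hu₀res : residue ↥R₁ ⟨(u₀ : K), hT u₀.2⟩ ≠ 0 := (residue_ne_zero_iff_coarse hR₁O₁ hinv ⟨(u₀ : K), hT u₀.2⟩).mpr hu₀
    rw [eq_div_iff hu₀res, ← map_mul]
    congr 1
    apply Subtype.ext
    change (y : K) / u₀ * u₀ = y
    rw [div_mul_cancel₀ _ (ne_zero_of_valuation_eq_one hu₀)]
  apply le_antisymm
  · -- `⊆`: the closure is contained in the subring of `K` of elements of `R₁` whose residue lies in the right-hand side
    set Cbar := Subring.closure ((((residue ↥R₁).comp (Subring.inclusion hT)).range : Set (ResidueField ↥R₁)) ∪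
        (fun y : ↥((residue ↥R₁).comp (Subring.inclusion hT)).range =>
          (y : ResidueField ↥R₁) / ((residue ↥R₁).comp (Subring.inclusion hT)).rangeRestrict u₀) ''
          ↑(u.image ((residue ↥R₁).comp (Subring.inclusion hT)).rangeRestrict)) with hCbar
    let F : Subring K := (Cbar.comap (residue ↥R₁)).map R₁.subtype
    have hFmem : ∀ w : K, w ∈ F ↔ ∃ hw : w ∈ R₁, residue ↥R₁ ⟨w, hw⟩ ∈ Cbar := by
      intro w
      constructor
      · rintro ⟨r, hr, rfl⟩; exact ⟨r.2, hr⟩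
      · rintro ⟨hw, hr⟩; exact ⟨⟨w, hw⟩, hr, rfl⟩
    have hle : Subring.closure ((T : Set K) ∪ (fun y : ↥T => (y : K) / u₀) '' ↑u) ≤ F := by
      rw [Subring.closure_le]
      rintro w (hw | ⟨y, hy, rfl⟩)
      · exact (hFmem w).mpr ⟨hT hw, Subring.subset_closure (Or.inl (residue_mem_img hT hw))⟩
      · refine (hFmem _).mpr ⟨hC (Subring.subset_closure (Or.inr ⟨y, hy, rfl⟩)), ?_⟩
        rw [hgen y hy]
        refine Subring.subset_closure (Or.inr ⟨((residue ↥R₁).comp (Subring.inclusion hT)).rangeRestrict y, ?_, rfl⟩)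
        exact Finset.mem_coe.mpr (Finset.mem_image_of_mem _ hy)
    intro ξ hξ
    obtain ⟨w, hw, rfl⟩ := (mem_img_iff hC ξ).mp hξ
    obtain ⟨hw', hr⟩ := (hFmem w).mp (hle hw)
    exact hr
  · -- `⊇`: the image is a subring containing the generators
    rw [Subring.closure_le]
    rintro ξ (hξ | ⟨y', hy', rfl⟩)
    · exact img_mono hT hC hTC hξ
    · obtain ⟨y, hy, rfl⟩ := Finset.mem_image.mp (Finset.mem_coe.mp hy')
      beta_reduce
      rw [← hgen y hy]
      exact residue_mem_img hC (Subring.subset_closure (Or.inr ⟨y, hy, rfl⟩))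

end image

end Summit.ResolutionOfSingularities.ResolutionOfSingularities.Theorems.RadicialJung.CleanModels.Ccurve

end
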